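import Summits.Ventures.DiscreteObjects.Hadamard.FixedStructure

/-!
# Hadamard 668 census, family F12 — permutation modules over a field for Lander's parity theorem (kernel)

Framing: lottery ticket; floor = certified bounds/negative ranges.

Cell pub-namedobj (venture DiscreteObjects), target (H), hadamard gen 8.  Linear algebra of the pull-back operator
`T = (u ↦ u ∘ τ)` (Mathlib `LinearMap.funLeft`) of a permutation `τ` with `τ^p = 1`, `p` prime, on the function space
`B → F` over a field `F`, in the vocabulary of `PrimeOrderAutomorphism` / `FixedStructure` (`orbFin`, `blockClasses`):
* `aeval_funLeft_apply` — `g(T) u y = Σ_k g_k u(τ^k y)`; `sum_aeval_funLeft` — `Σ_y g(T)u y = g(1) Σ_y u y`;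
  `aeval_funLeft_dotProduct` — the dot-product adjoint of `g(T)` is `g(T^{p-1}) = (g ∘ X^{p-1})(T)`;
* `dotProduct_eq_zero_of_mem_ker` — for complementary coprime factors `f₁ f₂ = X^p - 1` with `f₁ ∣ f₁(X^{p-1})`
  (self-reciprocal), `ker f₁(T) ⊥ ker f₂(T)`;
* `aeval_apply_of_comp_eq` — an intertwiner `L S = T L` intertwines `g(S)` and `g(T)`;
* `card_mul_natDegree_le_finrank_ker` — `#classes · deg f₁ ≤ dim ker f₁(T)`: the functions `(f₂ g)(T) δ_y`, `deg g < deg f₁`,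
  `y` a class representative, are independent (each `τ`-class of a moved block carries a copy of `F[X]/(X^p - 1)`);
  with `finrank_ker_add_finrank_ker` (`dim ker f₁(T) + dim ker f₂(T) = |B|`) this gives the exact count
  `finrank_ker_aeval_funLeft` = `#classes · deg f₁` when `τ` is fixed-point-free (`|B| = #classes · p`).
Ours, not literature; no `sorry`.  Used by `PrimeOrder29Parity` (Lander 1983 Thm 3.20(2) for the 2-(667,333,166) design).
-/

open Polynomial Finset BigOperators

namespace Summit.Ventures.DiscreteObjects.Hadamard

section intertwine
variable {F : Type*} [Field F] {M N : Type*} [AddCommGroup M] [Module F M] [AddCommGroup N] [Module F N]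

/-- an intertwiner of `S` and `T` intertwines their powers -/
lemma pow_apply_of_comp_eq (S : M →ₗ[F] M) (T : N →ₗ[F] N) (L : M →ₗ[F] N) (hL : L ∘ₗ S = T ∘ₗ L)
    (n : ℕ) (m : M) : L ((S ^ n) m) = (T ^ n) (L m) := by
  induction n generalizing m with
  | zero => simp
  | succ n ih =>
    rw [pow_succ, pow_succ, Module.End.mul_apply, Module.End.mul_apply, ih]
    congr 1
    exact LinearMap.congr_fun hL m

/-- **intertwiners pass through polynomials**: `L S = T L` implies `L g(S) = g(T) L` -/
theorem aeval_apply_of_comp_eq (S : M →ₗ[F] M) (T : N →ₗ[F] N) (L : M →ₗ[F] N) (hL : L ∘ₗ S = T ∘ₗ L)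
    (g : F[X]) (m : M) : L (aeval S g m) = aeval T g (L m) := by
  induction g using Polynomial.induction_on' generalizing m with
  | add p q hp hq => rw [map_add, map_add, LinearMap.add_apply, LinearMap.add_apply, map_add, hp, hq]
  | monomial n c =>
    rw [aeval_monomial, aeval_monomial, Module.End.mul_apply, Module.End.mul_apply, Module.algebraMap_end_apply,
      Module.algebraMap_end_apply, map_smul, pow_apply_of_comp_eq S T L hL]

/-- the kernel of `g(S)` is `S`-invariant -/
lemma mem_ker_aeval_of_mem_ker (S : M →ₗ[F] M) (g : F[X]) {m : M} (hm : m ∈ LinearMap.ker (aeval S g)) :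
    S m ∈ LinearMap.ker (aeval S g) := by
  rw [LinearMap.mem_ker] at hm ⊢
  have hc : aeval S g * aeval S (X : F[X]) = aeval S (X : F[X]) * aeval S g := by
    rw [← map_mul, ← map_mul, mul_comm]
  rw [aeval_X] at hc
  have := LinearMap.congr_fun hc m
  rw [Module.End.mul_apply, Module.End.mul_apply, hm, map_zero] at this
  exact this

end intertwine

section permModule
variable {F : Type*} [Field F] {B : Type*}

/-- powers of the pull-back operator are pull-backs by powers -/
lemma funLeft_pow (τ : Equiv.Perm B) (k : ℕ) :
    (LinearMap.funLeft F F τ) ^ k = LinearMap.funLeft F F ⇑(τ ^ k) := by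
  induction k with
  | zero =>
    rw [pow_zero, pow_zero, Equiv.Perm.coe_one]
    exact LinearMap.ext fun u => rfl
  | succ k ih =>
    rw [pow_succ, ih]
    refine LinearMap.ext fun u => funext fun y => ?_
    rw [pow_succ']
    simp only [Module.End.mul_apply, LinearMap.funLeft_apply, Equiv.Perm.mul_apply]

/-- `g(T) u y = Σ_k g_k · u (τ^k y)` -/
lemma aeval_funLeft_apply (τ : Equiv.Perm B) (g : F[X]) (u : B → F) (y : B) :
    aeval (LinearMap.funLeft F F τ) g u y = ∑ k ∈ range (g.natDegree + 1), g.coeff k * u ((τ ^ k) y) := by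
  rw [aeval_eq_sum_range, LinearMap.sum_apply, Finset.sum_apply]
  refine Finset.sum_congr rfl fun k _ => ?_
  rw [LinearMap.smul_apply, funLeft_pow, Pi.smul_apply, LinearMap.funLeft_apply, smul_eq_mul]

/-- `(X^p - 1)(T) = 0` when `τ^p = 1` -/
lemma aeval_X_pow_sub_one_funLeft (τ : Equiv.Perm B) {p : ℕ} (hτ : τ ^ p = 1) :
    aeval (LinearMap.funLeft F F τ) (X ^ p - 1 : F[X]) = 0 := by
  rw [map_sub, map_pow, aeval_X, map_one, funLeft_pow, hτ, sub_eq_zero, Equiv.Perm.coe_one]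
  exact LinearMap.ext fun u => rfl

/-- complementary factors of `X^p - 1`: non-zero and degrees add up to `p` -/
lemma natDegree_add_of_mul_eq {p : ℕ} (hp : 0 < p) {f₁ f₂ : F[X]} (hf : f₁ * f₂ = X ^ p - 1) :
    f₁ ≠ 0 ∧ f₂ ≠ 0 ∧ f₁.natDegree + f₂.natDegree = p := by
  have hne : (X ^ p - 1 : F[X]) ≠ 0 := by rw [← C_1]; exact X_pow_sub_C_ne_zero hp 1
  have h1 : f₁ ≠ 0 := by rintro rfl; rw [zero_mul] at hf; exact hne hf.symm
  have h2 : f₂ ≠ 0 := by rintro rfl; rw [mul_zero] at hf; exact hne hf.symm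
  refine ⟨h1, h2, ?_⟩
  rw [← natDegree_mul h1 h2, hf, ← C_1, natDegree_X_pow_sub_C]

/-- kernels of complementary factors are complements -/
theorem isCompl_ker_aeval_funLeft (τ : Equiv.Perm B) {p : ℕ} (hτ : τ ^ p = 1) {f₁ f₂ : F[X]}
    (hf : f₁ * f₂ = X ^ p - 1) (hcop : IsCoprime f₁ f₂) :
    IsCompl (LinearMap.ker (aeval (LinearMap.funLeft F F τ) f₁)) (LinearMap.ker (aeval (LinearMap.funLeft F F τ) f₂)) := by
  set T := LinearMap.funLeft F F τ with hT
  refine ⟨disjoint_ker_aeval_of_isCoprime T hcop, ?_⟩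
  rw [codisjoint_iff, sup_ker_aeval_eq_ker_aeval_mul_of_coprime T hcop, hf, hT, aeval_X_pow_sub_one_funLeft τ hτ,
    LinearMap.ker_zero]

section fintype
variable [Fintype B]

/-- `Σ_y g(T) u y = g(1) · Σ_y u y` -/
lemma sum_aeval_funLeft (τ : Equiv.Perm B) (g : F[X]) (u : B → F) :
    ∑ y, aeval (LinearMap.funLeft F F τ) g u y = g.eval 1 * ∑ y, u y := by
  simp_rw [aeval_funLeft_apply]
  rw [Finset.sum_comm, eval_eq_sum_range, Finset.sum_mul]
  refine Finset.sum_congr rfl fun k _ => ?_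
  rw [one_pow, mul_one, ← Finset.mul_sum]
  congr 1
  exact Equiv.sum_comp (τ ^ k) u

/-- **adjoint**: `⟨g(T) u, z⟩ = ⟨u, g(T^{p-1}) z⟩`, written with `g ∘ X^{p-1}` -/
lemma aeval_funLeft_dotProduct (τ : Equiv.Perm B) {p : ℕ} (hp : 0 < p) (hτ : τ ^ p = 1) (g : F[X])
    (u z : B → F) :
    aeval (LinearMap.funLeft F F τ) g u ⬝ᵥ z =
      u ⬝ᵥ aeval (LinearMap.funLeft F F τ) (g.comp (X ^ (p - 1))) z := by
  rw [aeval_comp, map_pow, aeval_X, funLeft_pow]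
  simp only [dotProduct, aeval_funLeft_apply, Finset.sum_mul, Finset.mul_sum]
  rw [Finset.sum_comm]
  conv_rhs => rw [Finset.sum_comm]
  refine Finset.sum_congr rfl fun k _ => ?_
  obtain ⟨q, rfl⟩ := Nat.exists_eq_succ_of_ne_zero hp.ne'
  have hid : ∀ y, (τ ^ k) (((τ ^ (q + 1 - 1)) ^ k) y) = y := by
    intro y
    rw [← Equiv.Perm.mul_apply, ← pow_mul, ← pow_add, Nat.add_sub_cancel,
      show k + q * k = (q + 1) * k by ring, pow_mul, hτ, one_pow, Equiv.Perm.one_apply]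
  rw [← Equiv.sum_comp ((τ ^ (q + 1 - 1)) ^ k) (fun y => g.coeff k * u ((τ ^ k) y) * z y)]
  refine Finset.sum_congr rfl fun y _ => ?_
  rw [hid]
  ring

/-- **orthogonality**: for complementary coprime factors with `f₁` self-reciprocal, `ker f₁(T) ⊥ ker f₂(T)` -/
theorem dotProduct_eq_zero_of_mem_ker (τ : Equiv.Perm B) {p : ℕ} (hp : 0 < p) (hτ : τ ^ p = 1) {f₁ f₂ : F[X]}
    (hcop : IsCoprime f₁ f₂) (hrec : f₁ ∣ f₁.comp (X ^ (p - 1))) {u z : B → F}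
    (hu : aeval (LinearMap.funLeft F F τ) f₁ u = 0) (hz : aeval (LinearMap.funLeft F F τ) f₂ z = 0) :
    u ⬝ᵥ z = 0 := by
  set T := LinearMap.funLeft F F τ with hT
  obtain ⟨a, b, hab⟩ := hcop
  -- z = f₁(T) (a(T) z)
  have hz' : z = aeval T f₁ (aeval T a z) := by
    have e := congrArg (fun q => aeval T q z) hab
    rw [mul_comm a f₁, map_add, map_mul, map_mul, map_one, LinearMap.add_apply, Module.End.mul_apply,
      Module.End.mul_apply, Module.End.one_apply, hz, map_zero, add_zero] at e
    exact e.symm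
  rw [hz', dotProduct_comm, hT, aeval_funLeft_dotProduct τ hp hτ f₁ _ u]
  obtain ⟨q, hq⟩ := hrec
  rw [hq, mul_comm f₁ q, map_mul, Module.End.mul_apply, ← hT, hu, map_zero, dotProduct_zero]

/-- **complementary kernels fill the space**: `dim ker f₁(T) + dim ker f₂(T) = |B|` -/
theorem finrank_ker_add_finrank_ker (τ : Equiv.Perm B) {p : ℕ} (hτ : τ ^ p = 1) {f₁ f₂ : F[X]}
    (hf : f₁ * f₂ = X ^ p - 1) (hcop : IsCoprime f₁ f₂) :
    Module.finrank F (LinearMap.ker (aeval (LinearMap.funLeft F F τ) f₁)) +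
      Module.finrank F (LinearMap.ker (aeval (LinearMap.funLeft F F τ) f₂)) = Fintype.card B := by
  set T := LinearMap.funLeft F F τ with hT
  have hsup : LinearMap.ker (aeval T f₁) ⊔ LinearMap.ker (aeval T f₂) = ⊤ := by
    rw [sup_ker_aeval_eq_ker_aeval_mul_of_coprime T hcop, hf, hT, aeval_X_pow_sub_one_funLeft τ hτ,
      LinearMap.ker_zero]
  have hinf : LinearMap.ker (aeval T f₁) ⊓ LinearMap.ker (aeval T f₂) = ⊥ :=
    (disjoint_ker_aeval_of_isCoprime T hcop).eq_bot
  have e := Submodule.finrank_sup_add_finrank_inf_eq (LinearMap.ker (aeval T f₁)) (LinearMap.ker (aeval T f₂))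
  rw [hsup, hinf, finrank_top, finrank_bot, add_zero, Module.finrank_fintype_fun_eq_card] at e
  exact e.symm

end fintype

section decEq
variable [DecidableEq B]

/-- `g(T) δ_{y₀}` pointwise -/
lemma aeval_funLeft_single_apply (τ : Equiv.Perm B) (g : F[X]) (y₀ y : B) :
    aeval (LinearMap.funLeft F F τ) g (Pi.single y₀ 1) y =
      ∑ k ∈ range (g.natDegree + 1), (if (τ ^ k) y = y₀ then g.coeff k else 0) := by
  rw [aeval_funLeft_apply]
  refine Finset.sum_congr rfl fun k _ => ?_
  rw [Pi.single_apply]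
  split_ifs <;> simp

/-- `g(T) δ_{y₀}` is supported on the class of `y₀` -/
lemma mem_orbFin_of_aeval_single_ne_zero (τ : Equiv.Perm B) {p : ℕ} (hp : p.Prime) (hτ : τ ^ p = 1) (g : F[X])
    {y₀ y : B} (h : aeval (LinearMap.funLeft F F τ) g (Pi.single y₀ 1) y ≠ 0) : y ∈ orbFin τ p y₀ := by
  rw [aeval_funLeft_single_apply] at h
  obtain ⟨k, -, hk⟩ := Finset.exists_ne_zero_of_sum_ne_zero h
  have hky : (τ ^ k) y = y₀ := by
    by_contra hne
    exact hk (if_neg hne)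
  by_cases hy : τ y = y
  · have : y = y₀ := by rw [← hky, perm_pow_apply_of_fixed τ hy k]
    rw [this]
    exact mem_orbFin_self τ hp.pos y₀
  · have hy₀ : y₀ ∈ orbFin τ p y := hky ▸ pow_apply_mem_orbFin τ hp.pos hτ y k
    rw [orbFin_eq_of_mem τ hp hτ hy hy₀]
    exact mem_orbFin_self τ hp.pos y

/-- coefficient extraction: `(g(T) δ_{y₀}) ((τ^j)⁻¹ y₀) = g_j` for `deg g < p`, `j < p`, `y₀` moved -/
lemma aeval_funLeft_single_coeff (τ : Equiv.Perm B) {p : ℕ} (hp : p.Prime) (hτ : τ ^ p = 1) {g : F[X]}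
    (hg : g.natDegree < p) {y₀ : B} (hy₀ : τ y₀ ≠ y₀) {j : ℕ} (hj : j < p) :
    aeval (LinearMap.funLeft F F τ) g (Pi.single y₀ 1) ((τ ^ j)⁻¹ y₀) = g.coeff j := by
  rw [aeval_funLeft_single_apply, Finset.sum_eq_single j]
  · have e : (τ ^ j) ((τ ^ j)⁻¹ y₀) = y₀ := by rw [← Equiv.Perm.mul_apply, mul_inv_cancel, Equiv.Perm.one_apply]
    rw [if_pos e]
  · intro k hk hkj
    have hk' : k < p := by have := Finset.mem_range.mp hk; omega
    have hc : (τ ^ k) * (τ ^ j)⁻¹ = (τ ^ j)⁻¹ * (τ ^ k) := ((Commute.refl τ).pow_pow k j).inv_right.eq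
    rw [if_neg]
    intro e
    apply hkj
    rw [← Equiv.Perm.mul_apply, hc, Equiv.Perm.mul_apply, Equiv.Perm.inv_eq_iff_eq] at e
    exact perm_pow_apply_injective τ hp hτ hy₀ hk' hj e
  · intro hmem
    rw [coeff_eq_zero_of_natDegree_lt (by rw [Finset.mem_range] at hmem; omega)]
    simp

/-- injectivity: `g(T) δ_{y₀} = 0` with `deg g < p`, `y₀` moved, forces `g = 0` -/
lemma eq_zero_of_aeval_single_eq_zero (τ : Equiv.Perm B) {p : ℕ} (hp : p.Prime) (hτ : τ ^ p = 1) {g : F[X]}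
    (hg : g.natDegree < p) {y₀ : B} (hy₀ : τ y₀ ≠ y₀)
    (h0 : aeval (LinearMap.funLeft F F τ) g (Pi.single y₀ 1) = 0) : g = 0 := by
  ext j
  rw [coeff_zero]
  by_cases hj : j < p
  · rw [← aeval_funLeft_single_coeff τ hp hτ hg hy₀ hj, h0, Pi.zero_apply]
  · exact coeff_eq_zero_of_natDegree_lt (by omega)

end decEq

section both
variable [Fintype B] [DecidableEq B]

/-- **lower bound**: `#classes · deg f₁ ≤ dim ker f₁(T)` for complementary factors `f₁ f₂ = X^p - 1` -/
theorem card_mul_natDegree_le_finrank_ker (τ : Equiv.Perm B) {p : ℕ} (hp : p.Prime) (hτ : τ ^ p = 1)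
    {f₁ f₂ : F[X]} (hf : f₁ * f₂ = X ^ p - 1) :
    (blockClasses τ p).card * f₁.natDegree ≤
      Module.finrank F (LinearMap.ker (aeval (LinearMap.funLeft F F τ) f₁)) := by
  obtain ⟨hf₁0, hf₂0, hdeg⟩ := natDegree_add_of_mul_eq hp.pos hf
  set T := LinearMap.funLeft F F τ with hT
  have hTp : aeval T (X ^ p - 1 : F[X]) = 0 := aeval_X_pow_sub_one_funLeft τ hτ
  set d := f₁.natDegree with hd
  -- class representatives
  have hrep : ∀ C : {C // C ∈ blockClasses τ p}, ∃ y₀, τ y₀ ≠ y₀ ∧ C.1 = orbFin τ p y₀ := by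
    rintro ⟨C, hC⟩
    obtain ⟨y₀, hy₀, rfl⟩ := Finset.mem_image.mp hC
    exact ⟨y₀, (Finset.mem_filter.mp hy₀).2, rfl⟩
  choose rep hrep_mv hrep_eq using hrep
  -- the comparison map
  let Λ : ({C // C ∈ blockClasses τ p} → degreeLT F d) →ₗ[F] (B → F) :=
    { toFun := fun g => ∑ C, aeval T (f₂ * (g C : F[X])) (Pi.single (rep C) 1)
      map_add' := by
        intro g g'
        rw [← Finset.sum_add_distrib]
        refine Finset.sum_congr rfl fun C _ => ?_
        rw [Pi.add_apply, Submodule.coe_add, mul_add, map_add, LinearMap.add_apply]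
      map_smul' := by
        intro c g
        rw [RingHom.id_apply, Finset.smul_sum]
        refine Finset.sum_congr rfl fun C _ => ?_
        rw [Pi.smul_apply, Submodule.coe_smul, mul_smul_comm, map_smul, LinearMap.smul_apply] }
  have hΛ : ∀ g, Λ g = ∑ C, aeval T (f₂ * (g C : F[X])) (Pi.single (rep C) 1) := fun g => rfl
  -- (i) the image lies in ker f₁(T)
  have hrange : LinearMap.range Λ ≤ LinearMap.ker (aeval T f₁) := by
    rintro _ ⟨g, rfl⟩
    rw [LinearMap.mem_ker, hΛ, map_sum]
    refine Finset.sum_eq_zero fun C _ => ?_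
    rw [← Module.End.mul_apply, ← map_mul, ← mul_assoc, hf, mul_comm (X ^ p - 1 : F[X]) (g C : F[X]), map_mul,
      Module.End.mul_apply, hTp, LinearMap.zero_apply, map_zero]
  -- (ii) Λ is injective
  have hinj : Function.Injective Λ := by
    rw [← LinearMap.ker_eq_bot, LinearMap.ker_eq_bot']
    intro g hg
    rw [hΛ] at hg
    funext C
    -- the C-summand vanishes on its class, hence everywhere
    have hdegC : (f₂ * (g C : F[X])).natDegree < p := by
      by_cases hgC : (g C : F[X]) = 0
      · rw [hgC, mul_zero, natDegree_zero]; exact hp.pos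
      · have hlt : (g C : F[X]).natDegree < d := by
          have hmem := (g C).2
          rw [mem_degreeLT] at hmem
          exact (natDegree_lt_iff_degree_lt hgC).mpr hmem
        rw [natDegree_mul hf₂0 hgC]
        omega
    have hzero : aeval T (f₂ * (g C : F[X])) (Pi.single (rep C) 1) = 0 := by
      funext y
      rw [Pi.zero_apply]
      by_cases hy : y ∈ C.1
      · -- evaluate the whole sum at y: only the C-term survives
        have e := congrFun hg y
        rw [Finset.sum_apply, Pi.zero_apply, Finset.sum_eq_single C] at e
        · exact e
        · intro C' _ hne
          by_contra hne'
          have hy' : y ∈ C'.1 := by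
            rw [hrep_eq C']
            exact mem_orbFin_of_aeval_single_ne_zero τ hp hτ _ hne'
          have hdisj : Disjoint C'.1 C.1 := blockClasses_disjoint τ hp hτ C'.2 C.2 (fun h => hne (Subtype.ext h))
          exact Finset.disjoint_left.mp hdisj hy' hy
        · intro h; exact absurd (Finset.mem_univ C) h
      · by_contra hne
        apply hy
        rw [hrep_eq C]
        exact mem_orbFin_of_aeval_single_ne_zero τ hp hτ _ hne
    have hprod : f₂ * (g C : F[X]) = 0 := eq_zero_of_aeval_single_eq_zero τ hp hτ hdegC (hrep_mv C) hzero
    rcases mul_eq_zero.mp hprod with h | h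
    · exact absurd h hf₂0
    · exact Subtype.ext h
  -- (iii) dimension of the source
  have hsrc : Module.finrank F ({C // C ∈ blockClasses τ p} → degreeLT F d) = (blockClasses τ p).card * d := by
    rw [Module.finrank_pi_fintype, Finset.sum_const, Finset.card_univ, Fintype.card_coe, smul_eq_mul,
      (degreeLTEquiv F d).finrank_eq, Module.finrank_fin_fun]
  -- conclude
  calc (blockClasses τ p).card * d
      = Module.finrank F (LinearMap.range Λ) := by rw [LinearMap.finrank_range_of_inj hinj, hsrc]
    _ ≤ Module.finrank F (LinearMap.ker (aeval T f₁)) := Submodule.finrank_mono hrange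

/-- **exact count for a fixed-point-free `τ`**: `dim ker f₁(T) = #classes · deg f₁` when `|B| = #classes · p` -/
theorem finrank_ker_aeval_funLeft (τ : Equiv.Perm B) {p : ℕ} (hp : p.Prime) (hτ : τ ^ p = 1) {f₁ f₂ : F[X]}
    (hf : f₁ * f₂ = X ^ p - 1) (hcop : IsCoprime f₁ f₂) (hcard : Fintype.card B = (blockClasses τ p).card * p) :
    Module.finrank F (LinearMap.ker (aeval (LinearMap.funLeft F F τ) f₁)) = (blockClasses τ p).card * f₁.natDegree := by
  obtain ⟨-, -, hdeg⟩ := natDegree_add_of_mul_eq hp.pos hf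
  have h1 := card_mul_natDegree_le_finrank_ker τ hp hτ hf
  have h2 := card_mul_natDegree_le_finrank_ker τ hp hτ ((mul_comm f₂ f₁).trans hf)
  have h3 := finrank_ker_add_finrank_ker τ hτ hf hcop
  have h4 : (blockClasses τ p).card * p = (blockClasses τ p).card * f₁.natDegree + (blockClasses τ p).card * f₂.natDegree := by
    rw [← mul_add, hdeg]
  rw [hcard] at h3
  omega

end both

end permModule

end Summit.Ventures.DiscreteObjects.Hadamard
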